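import Literature.NumberTheory.IwasawaTheory.ClassicalLambdaInvariant
import Summits.BirchSwinnertonDyer.BirchSwinnertonDyer.Theorems.TwoAdicConverseOrdLambdaHalfAtTwoGL1ResidualLineCount
import Literature.NumberTheory.EllipticCurves.HeegnerPoints
import HarnessLib

/-!
# Route `TwoAdicConverse` (rung S3), crux `OrdLambdaHalfAtTwo` (item stmt-BirchSwinnertonDyer-19556), line `kato_determinant_greenberg_two`:
# the MEETING EXPONENT `Q` of the `GL(1)` re-cut (pen RC-382 (1)), TYPED as an explicit natural number, and its algebraic gloss 6b (displayed binder)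

Seat `cruxlead-stmt-BirchSwinnertonDyer-19556` g4 (LEAD PROVER, MODE LINE).  DEFINITIONS ONLY (one `def : ℕ`, one displayed `def : Prop`; nothing asserted;
no instance, no `sorry`).  HONEST FRAMING (cell bsd-2adic): BSD is not proved by any of this; the crux is NOT proved here.

* `meetingExponentQ κK N : ℕ := classicalLambda κK − 1 + Σ_{ℓ ∣ N prime} 2^{ord₂(ℓ² − 1) − 2}` — pen RC-382 (1) VERBATIM («`Q(D,N) := λ₂(ℚ(√−D)) − 1 +
  Σ_{ℓ ∣ N} 2^{ord₂(ℓ²−1) − 2}` … NO `c`, `c′`, `halfLift` in the DEFINITION»), over the tree's `classicalLambda` (growth-form `λ` of the `ℤ₂`-extension `κK`;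
  intended: the CYCLOTOMIC `ℤ₂`-extension of the Greenberg field `K = ℚ(√−D)`, every prime of `2N` split in `K`).  `ℕ`-subtractions documented: `λ₂(K) ≥ 1`
  for an imaginary quadratic `K` in which `2` splits (Ferrero 1980 / Kida 1979), and `ord₂(ℓ² − 1) ≥ 3` for odd `ℓ`; junk otherwise.  Reading: `Q + 2 =
  #{primes of ℚ_∞ over the odd part of D} + #{primes of K_∞ over N}` (triage r1-2 GEN 23, `qan-closedform-check.txt`: 80/80 rows of cdisprove's DATA (7)).
* `ResidualCountEqQAtTwo` (6b, displayed binder, PRINT-GRADE `GL(1)`: Ferrero 1980 / Kida 1979 for `λ₂`, genus theory over `K_∞` for the primes over `N`,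
  Ferrero–Washington `μ = 0`; numerically 70/70 stabilised rows `d_S = Q`): for `K` imaginary quadratic with the Heegner hypothesis for `2N` (`N` odd), its
  cyclotomic `ℤ₂`-extension `κK`, `w ∣ 2` and ANY discrete `Γ_K`-module `M` of order `2`, the residual Castella group `R_w^Σ(K_∞, M)` — unramified outside
  `Σ ∪ {v ∣ 2}`, strict at `w`, relaxed at `w̄`, `Σ` = the primes of `K` dividing `N` — has EXACTLY `2^{Q(κK, N)}` elements.  NOT a stub of the line (skeleton
  v4.7's stubs are unchanged); the kernel use is the corollary «6‴ ⟸ 6b ∧ (Glob) ∧ (Loc) ∧ [2^{gD+corank}·#X^Σ[2]·#(E(K_∞)[2^∞]/2)·2 ≤ 4^{Q}]» through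
  `…GL1ResidualLineCount.sq_le_two_pow_lambda_mul_cyclotomic_two` (the GL(1) sandwich), and the ANALYTIC gloss (Greither 1992's IMC at `p = 2`, Q_an of
  conv-1's D2) lives in the docstring of the research stub only.

References: [FerreroWashington1979]; [Ferrero1978] (Iwasawa invariants of abelian fields); [Washington1997] §13.3; [GreenbergVatsal2000] §2; pen RC-382; triage r1-2 GEN 23.
-/

set_option linter.dupNamespace false
set_option autoImplicit false

noncomputable section

open scoped Classical
open NumberField IsDedekindDomain Field
open Literature.NumberTheory.EllipticCurves Literature.NumberTheory.EllipticCurves.GreenbergVatsal2000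
  Literature.NumberTheory.IwasawaTheory
  Summit.BirchSwinnertonDyer.Rank1Residual.X11b

namespace Summit.BirchSwinnertonDyer.BirchSwinnertonDyer.Theorems.TwoAdicKatoDeterminant

/-- **The meeting exponent `Q(κK, N)` of line `kato_determinant_greenberg_two`** (pen RC-382 (1) verbatim): `λ₂(K) − 1 + Σ_{ℓ ∣ N prime} 2^{ord₂(ℓ²−1) − 2}`,
`λ₂(K) = classicalLambda κK` the growth-form `λ` of the `ℤ₂`-extension `κK` of `K` (intended: `K = ℚ(√−D)` a Greenberg field of the curve, `κK` its CYCLOTOMIC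
`ℤ₂`-extension, `N` the conductor).  `ℕ`-subtraction junk documented in the module docstring (`λ₂(K) ≥ 1` when `2` splits in the imaginary quadratic `K`;
`ord₂(ℓ²−1) ≥ 3` for odd `ℓ`).  A DEFINITION; nothing asserted. [cite: Ferrero1978, §1 (Iwasawa invariants of abelian fields; shape only)] -/
def meetingExponentQ {K : Type} [Field K] (κK : ZpExtension K 2) (N : ℕ) : ℕ :=
  classicalLambda κK - 1 + ∑ ℓ ∈ N.primeFactors, 2 ^ (padicValNat 2 (ℓ ^ 2 - 1) - 2)

/-- [print grade, GL(1) — displayed binder 6b of the line's v5 gloss; NOT a registered stub] **The residual count equals `2^Q`.**  For an imaginary quadratic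
`K` satisfying the Heegner hypothesis for `2N` (`N` odd: every prime of `2N` splits in `K`), its cyclotomic `ℤ₂`-extension `κK`, a prime `w ∣ 2` of `K`, and ANY
discrete `Γ_K`-module `M` of order `2` (necessarily the trivial action), the residual group `R_w^Σ(K_∞, M) = datumStrictSelmer (ker κK) M 2 (bdpData M 2 w) Σ`
with `Σ` = the primes of `K` dividing `N` has exactly `2^{Q(κK, N)}` elements: `dim_{𝔽₂} Hom(Gal(𝔐_Σ/K_∞), 𝔽₂) = λ₂(K) − 1 + #{primes of K_∞ over N}` for the
maximal abelian pro-`2` extension `𝔐_Σ` of `K_∞` unramified outside `Σ ∪ {w̄}` and split at `w` (Ferrero–Washington `μ = 0`; Ferrero 1980 / Kida 1979 for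
`λ₂(K)`; genus theory along `K_∞/K` for the primes over `N`, each of which splits into `2^{ord₂(ℓ²−1)−3}` primes of `K_∞`).  Numerically: triage r1-2 GEN 23
(`qan-closedform-check.txt`), 70/70 stabilised rows of cdisprove's DATA (7).  Nothing asserted. [cite: FerreroWashington1979, Theorem (μ = 0 for abelian fields)]
[cite: Washington1997, §13.3 Thm. 13.13] [cite: GreenbergVatsal2000, §2 pp. 16–20 (the residual Selmer groups; shape only)]
Tagged `conjecture` as a DISPLAYED BINDER of the line (print-grade `GL(1)` statement with no tree theorem yet — OPEN IN THE TREE, like the line's other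
binders `ThetaShapiroKatoGreenbergSupplyAtTwo` / `ResidualGL1FinitenessAtTwo`); it is stated over the Summits-side `AcSelmer.bdpData`, so it is not a Literature fact. -/
@[conjecture] def ResidualCountEqQAtTwo : Prop :=
  ∀ (K : Type) [Field K] [NumberField K], IsImaginaryQuadratic K →
    ∀ (N : ℕ), Odd N → SatisfiesHeegnerHypothesis (2 * N) K →
    ∀ (κK : ZpExtension K 2), κK.IsCyclotomic →
    ∀ (w : HeightOneSpectrum (𝓞 K)), ((2 : ℕ) : 𝓞 K) ∈ w.asIdeal →
    ∀ (M : Type) [AddCommGroup M] [DistribMulAction (absoluteGaloisGroup K) M] [TopologicalSpace M] [DiscreteTopology M],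
      Nat.card M = 2 →
      Nat.card (datumStrictSelmer κK.kerSubgroup M 2 (AcSelmer.bdpData M 2 w)
          {v : HeightOneSpectrum (𝓞 K) | ((N : ℕ) : 𝓞 K) ∈ v.asIdeal}) =
        2 ^ meetingExponentQ κK N

end Summit.BirchSwinnertonDyer.BirchSwinnertonDyer.Theorems.TwoAdicKatoDeterminant

end
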